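import Summits.AtomisticToContinuum.FouriersLaw.Theorems.VanishingNoiseTransferNoisyFourierOfStorageDecay
import Summits.AtomisticToContinuum.FouriersLaw.Theorems.VanishingNoiseTransferNoisyFourierPatternStorage
import Summits.AtomisticToContinuum.FouriersLaw.Theorems.VanishingNoiseTransferNoisyFourierFixedAbelTLOfTimeProfile
import Summits.AtomisticToContinuum.FouriersLaw.Theorems.VanishingNoiseTransferNoisyFourierTimeProfileMatchingOfFlipTL
import Summits.AtomisticToContinuum.FouriersLaw.Theorems.VanishingNoiseTransferNoisyFourierThomsonWitnessBulkPositivity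
import Summits.AtomisticToContinuum.FouriersLaw.Theorems.VanishingNoiseTransferNoisyFourierKuboFloorOfBulkPositivity
import HarnessLib.Audit

/-!
# Line `abel-storage-decay` — crux `VanishingNoiseTransfer.NoisyFourier` (stmt-AtomisticToContinuum-11977)
# lead c7 skeleton v5 (2026-08-17): imports + TWO registered stubs {T2, PS} — B CLOSED (p163165)

The Abel–Green–Kubo line of leads c4/c5 in the strategist's re-typing, picked and reshaped by lead c6 (`PICKED.md`).
Everything except the three stubs below is LANDED (c1–c5 p-ids as in `Lines/abel-storage-decay.md`; c6: real-analysis core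
p148255, pattern storage p148902, composition p148910; wave 1: free ℓ²-row bound + `A4 ⇐ bulk row homogeneity` p150522,
`A4 ⇐ time profile` p151219, `P ⟺ bulk Abel–GK positivity given A4, U⁺` p150835, `P ⇐ A7` p150333; wave 2: T1 = fixed-`L`
time-profile representation p155414 (+ Dyson–Phillips/Gibbs invariance p153027, flip semigroup with Gibbs invariance and
Laplace–Neumann identity p153377, mild-corrector Neumann series p153610, invariant-kernel autocorrelation bound p154963), level-`s`
Thomson lower bound + `witness family ⇒ B` p155218, corrector pairing identity p153455, pairing-defect identity
`⟨w, j_i⟩ = ⟨E_{≤i}, P₀Xw⟩` p155531).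

STUBS (v5; c7: TPM → T2 `stub_flipTimeProfileTL` via the landed glue p157560; B `stub_bulkAbelGKPositivity` LANDED p163165 —
Thomson witness v = Σ_k (X_{k+1} − X_k)(p_kp_{k+1}/V″(r_k)), P₀Xv = p_0² − p_{L−1}², ⟨J,v⟩ = (L−1)T²; 20 helper files):
* TPM `stub_timeProfileMatching` (replaces c4's A4): the flip-chain current autocorrelation profile `c_L(t)` is measurable,
  `O(L−1)`-bounded, Laplace-represents EVERY classical Abel pairing (`∫ J_L u dμ_T = ∫₀^∞ e^{-st} c_L(t) dt`, all `s > 0`) — this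
  half (T1) is LANDED for the Dyson–Phillips flip semigroup `exists_flipSemigroup_gibbs` (`abelTimeProfile_of_family`,
  `abelTimeProfileRepresentation`, p155414) — AND converges per length at a.e. fixed time (`c_L(t)/(L−1) → C(t)`; T2 = flip
  light cone + bulk window matching: the open content, an infrastructure programme F0–F4 charted in the evidence file
  `A4_flip_locality_survey.md`). `TPM ⇒ A4` = `helper_fixedAbelTLOfTimeProfile` (p151219). Assembly recipe for the final TPM
  proof: `T1_notes.md` (evidence).
* PS `stub_patternStorageDecay` (lead c6; the Fourier core): `s·∫(P₀u_{L,s})² dμ_T ≤ C(L−1)s^a`; `PS ⇒ U⁺` landed (p148902).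
* B `stub_bulkAbelGKPositivity` (replaces the finite-volume floor P; NECESSARY, `P → B` landed): a floor `κ₀T²` on the fixed-`s`
  per-bond limits; `A4 → U⁺ → B → P` landed (p150835); `B ⇐ asymptotically half-conserved witness family` landed (p155218) and the
  pairing-defect identity (p155531) shows exact witnesses pair to ZERO with the current and local δ-families need a Mazur-type
  local continuous symmetry that pinning kills — B ≡ the bulk Green–Kubo floor for flips alone (open in print, BO2011 §6.2);
  `B_notes.md` (evidence).

`NoisyFourier_of` concludes the crux BY NAME. Disproof.lean honoured (`γ, ε > 0` in every stub; no pointwise-in-`N` law; no steady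
state / `δ`-limit / family in any stub).
-/
noncomputable section

open MeasureTheory Filter Topology
open scoped BigOperators

namespace Summit.AtomisticToContinuum.FouriersLaw.Cruxes.NoisyFourier.AbelStorageDecay

open Literature.MathematicalPhysics.KineticTheory.HeatConduction
open Summit.AtomisticToContinuum.FouriersLaw.Theses.VanishingNoiseTransfer (NoisyFourier)
open Summit.AtomisticToContinuum.FouriersLaw.Theorems.NoisyFourier.StorageDecay
  (noisyFourier_of_storageDecayParts storageDecay_of_patternStorageDecay)

open Summit.AtomisticToContinuum.FouriersLaw.Cruxes.NoisyFourier.AbelKapitzaEvenCorrector (helper_fixedAbelTLOfTimeProfile)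

/-! ## Registered stubs (`sorry` only here) -/

/-- STUB T2 — FLIP TIME-PROFILE THERMODYNAMIC LIMIT, family form (lead c7; replaces TPM, whose fixed-`L` half T1 is
landed as `abelTimeProfile_of_family` p155414 and whose glue `T2 → TPM` is landed as
`helper_timeProfileMatchingOfFlipTimeProfileTL` p157560): for EVERY admissible family `V = (V_L)_{L ≥ 1}` of equilibrium
flip semigroups (Markov, jointly measurable, `μ_T`-invariant, Laplace–Neumann identity of `exists_flipSemigroup_gibbs` —
the four spec clauses of `helper_flipSemigroupGibbs`) and a.e. `t > 0`, the per-length current autocorrelation profile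
`c_L(t)/(L − 1)`, `c_L(t) = ∫ J_L(z) (∫ J_L dV_{L,t}(z,·)) dμ_T(z)` (`c_0 := 0`), converges as `L → ∞` (flip light cone at
fixed time + bulk window matching; the flip twin of the deterministic registered `stub_fixedTimeMatching` of
stmt-AtomisticToContinuum-14013; by T1 the profile is family-independent for a.e. `t`). [cite: BernardinOlla2011, §5] -/
theorem stub_flipTimeProfileTL :
      ∀ (ω₂ lam β γ : ℝ) (hω : 0 < ω₂) (hl : 0 < lam) (hβ : 0 < β) (hγ : 0 < γ) (T : ℝ) (hT : 0 < T) (ε : ℝ), 0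
      < ε → ∀ V : (L : ℕ) → 0 < L → NNReal → ProbabilityTheory.Kernel
      (Literature.MathematicalPhysics.KineticTheory.HeatConduction.PhaseSpace L)
      (Literature.MathematicalPhysics.KineticTheory.HeatConduction.PhaseSpace L), (∀ (L : ℕ) (hL : 0 < L) (t :
      NNReal), ProbabilityTheory.IsMarkovKernel (V L hL t)) → (∀ (L : ℕ) (hL : 0 < L), Measurable fun p : NNReal
      × Literature.MathematicalPhysics.KineticTheory.HeatConduction.PhaseSpace L => V L hL p.1 p.2) → (∀ (L : ℕ)
      (hL : 0 < L) (t : NNReal), ((Literature.MathematicalPhysics.KineticTheory.HeatConduction.pinnedChain ω₂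
      lam β γ).gibbsMeasure L T).bind (V L hL t) =
      (Literature.MathematicalPhysics.KineticTheory.HeatConduction.pinnedChain ω₂ lam β γ).gibbsMeasure L T) →
      (∀ (L : ℕ) (hL : 0 < L) (a : ℝ), 0 < a → ∀ W : ℕ → ProbabilityTheory.Kernel
      (Literature.MathematicalPhysics.KineticTheory.HeatConduction.PhaseSpace L)
      (Literature.MathematicalPhysics.KineticTheory.HeatConduction.PhaseSpace L), W 0 =
      (Literature.MathematicalPhysics.KineticTheory.HeatConduction.pinnedChainSemigroup hω (le_of_lt hl)
      (le_of_lt hβ) (le_of_lt hγ) hL (le_of_lt hT) (le_of_lt hT)).resolventKernel (a + (L : ℝ) * ε) → (∀ n, W (n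
      + 1) = ProbabilityTheory.Kernel.comp
      ((Literature.MathematicalPhysics.KineticTheory.HeatConduction.pinnedChainSemigroup hω (le_of_lt hl)
      (le_of_lt hβ) (le_of_lt hγ) hL (le_of_lt hT) (le_of_lt hT)).resolventKernel (a + (L : ℝ) * ε))
      (ProbabilityTheory.Kernel.comp (Literature.MathematicalPhysics.KineticTheory.HeatConduction.flipKernel L)
      (W n))) → ∀ φ : Literature.MathematicalPhysics.KineticTheory.HeatConduction.PhaseSpace L → ENNReal,
      Measurable φ → ∀ z : Literature.MathematicalPhysics.KineticTheory.HeatConduction.PhaseSpace L,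
      MeasureTheory.lintegral (ProbabilityTheory.expMeasure a) (fun t => MeasureTheory.lintegral (V L hL
      t.toNNReal z) (fun y => φ y)) = ∑' n, ENNReal.ofReal (a / (a + (L : ℝ) * ε) * ((L : ℝ) * ε / (a + (L : ℝ)
      * ε)) ^ n) * MeasureTheory.lintegral (W n z) (fun y => φ y)) → Filter.Eventually (fun t : ℝ => ∃ K : ℝ,
      Filter.Tendsto (fun L : ℕ => (if hL : 0 < L then MeasureTheory.integral
      ((Literature.MathematicalPhysics.KineticTheory.HeatConduction.pinnedChain ω₂ lam β γ).gibbsMeasure L T)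
      (fun z => (∑ i : Fin L, (Literature.MathematicalPhysics.KineticTheory.HeatConduction.pinnedChain ω₂ lam β
      γ).bondCurrent L i z) * MeasureTheory.integral (V L hL t.toNNReal z) (fun y => ∑ i : Fin L,
      (Literature.MathematicalPhysics.KineticTheory.HeatConduction.pinnedChain ω₂ lam β γ).bondCurrent L i y))
      else 0) / ((L : ℝ) - 1)) Filter.atTop (nhds K)) (MeasureTheory.ae (MeasureTheory.volume.restrict (Set.Ioi
      (0 : ℝ)))) := by
  sorry

/-- TPM (time-profile matching, the former stub `stub_timeProfileMatching`, c6) from T2 by the landed glue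
`helper_timeProfileMatchingOfFlipTimeProfileTL` (p157560: T1 `abelTimeProfile_of_family` for the flip semigroups of
`exists_flipSemigroup_gibbs`, the a.e. limit from T2 for the same family, `C := limUnder`). [cite: BernardinOlla2011, §5] -/
theorem timeProfileMatching :
    ∀ (ω₂ lam β γ T ε : ℝ), 0 < ω₂ → 0 < lam → 0 < β → 0 < γ → 0 < T → 0 < ε → ∃ B : ℝ, ∃ c : ℕ → ℝ → ℝ, ∃ C : ℝ → ℝ,
      (∀ L : ℕ, Measurable (c L)) ∧ (∀ L : ℕ, 2 ≤ L → ∀ t : ℝ, 0 < t → |c L t| ≤ B * ((L : ℝ) - 1)) ∧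
      (Filter.Eventually (fun t : ℝ => Filter.Tendsto (fun L : ℕ => c L t / ((L : ℝ) - 1)) Filter.atTop (nhds (C t)))
      (MeasureTheory.ae (MeasureTheory.volume.restrict (Set.Ioi (0 : ℝ))))) ∧ ∀ (L : ℕ), 2 ≤ L → ∀ s : ℝ, 0 < s → ∀ u
      : Literature.MathematicalPhysics.KineticTheory.HeatConduction.PhaseSpace L → ℝ, (ContDiff ℝ 2 u ∧
      MeasureTheory.MemLp u 2 ((Literature.MathematicalPhysics.KineticTheory.HeatConduction.pinnedChain ω₂ lam β
      γ).gibbsMeasure L T) ∧ ∀ x, (Literature.MathematicalPhysics.KineticTheory.HeatConduction.pinnedChain ω₂ lam β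
      γ).flipGenerator L T T ε u x = s * u x - ∑ i : Fin L,
      (Literature.MathematicalPhysics.KineticTheory.HeatConduction.pinnedChain ω₂ lam β γ).bondCurrent L i x) →
      MeasureTheory.integral ((Literature.MathematicalPhysics.KineticTheory.HeatConduction.pinnedChain ω₂ lam β
      γ).gibbsMeasure L T) (fun x => (∑ i : Fin L,
      (Literature.MathematicalPhysics.KineticTheory.HeatConduction.pinnedChain ω₂ lam β γ).bondCurrent L i x) * u x)
      = MeasureTheory.integral (MeasureTheory.volume.restrict (Set.Ioi (0 : ℝ))) (fun t => Real.exp (-(s * t)) * c L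
      t) :=
  helper_timeProfileMatchingOfFlipTimeProfileTL stub_flipTimeProfileTL

/-- STUB PS — PATTERN-STORAGE DECAY (lead c6; the Fourier-law core of the line): there are `a ∈ (0,1]` and `C ≥ 0`
such that for all `L ≥ 2`, all `s ∈ (0,1]` and every classical Abel corrector `u` at `s`, the storage of its
pattern average satisfies `s · ∫ (P₀u)² dμ_T ≤ C · (L − 1) · s^a`,
`P₀u(q,p) = 2^{-L} Σ_{w ∈ {0,1}^L} u(q, (±_w p_i)_i)`. Predicted `a = 1/2` (two diffusive boundary layers of width
`√(D/s)`; saturation `‖P₀u_0‖² = O(L)` = first-order local equilibrium). [cite: BernardinOlla2011, Thm 2] -/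
theorem stub_patternStorageDecay :
    ∀ (ω₂ lam β γ T ε : ℝ), 0 < ω₂ → 0 < lam → 0 < β → 0 < γ → 0 < T → 0 < ε → ∃ a C : ℝ, 0 < a ∧ a ≤ 1 ∧ 0 ≤ C ∧ ∀
      (L : ℕ), 2 ≤ L → ∀ s : ℝ, 0 < s → s ≤ 1 → ∀ u :
      Literature.MathematicalPhysics.KineticTheory.HeatConduction.PhaseSpace L → ℝ, (ContDiff ℝ 2 u ∧
      MeasureTheory.MemLp u 2 ((Literature.MathematicalPhysics.KineticTheory.HeatConduction.pinnedChain ω₂ lam β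
      γ).gibbsMeasure L T) ∧ ∀ x, (Literature.MathematicalPhysics.KineticTheory.HeatConduction.pinnedChain ω₂ lam β
      γ).flipGenerator L T T ε u x = s * u x - ∑ i : Fin L,
      (Literature.MathematicalPhysics.KineticTheory.HeatConduction.pinnedChain ω₂ lam β γ).bondCurrent L i x) → s *
      MeasureTheory.integral ((Literature.MathematicalPhysics.KineticTheory.HeatConduction.pinnedChain ω₂ lam β
      γ).gibbsMeasure L T) (fun x => ((∑ w : Fin L → Bool, u (x.1, fun i => if w i then -x.2 i else x.2 i)) / 2 ^ L)
      ^ 2) ≤ C * ((L : ℝ) - 1) * s ^ a := by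
  sorry

/-! ## Composition (landed pieces only) -/

/-- A4 (fixed-`s` thermodynamic limit, the former stub) from TPM by the landed dominated-convergence glue
`helper_fixedAbelTLOfTimeProfile` (p151219). [folklore] -/
theorem fixedAbelThermodynamicLimit :
    ∀ (ω₂ lam β γ T ε : ℝ), 0 < ω₂ → 0 < lam → 0 < β → 0 < γ → 0 < T → 0 < ε → ∀ s : ℝ, 0 < s → s ≤ 1 → ∀ u : (L : ℕ)
      → Literature.MathematicalPhysics.KineticTheory.HeatConduction.PhaseSpace L → ℝ, (∀ L : ℕ, 2 ≤ L → ContDiff ℝ 2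
      (u L) ∧ MeasureTheory.MemLp (u L) 2 ((Literature.MathematicalPhysics.KineticTheory.HeatConduction.pinnedChain
      ω₂ lam β γ).gibbsMeasure L T) ∧ ∀ x, (Literature.MathematicalPhysics.KineticTheory.HeatConduction.pinnedChain
      ω₂ lam β γ).flipGenerator L T T ε (u L) x = s * u L x - ∑ i : Fin L,
      (Literature.MathematicalPhysics.KineticTheory.HeatConduction.pinnedChain ω₂ lam β γ).bondCurrent L i x) → ∃ K :
      ℝ, Filter.Tendsto (fun L : ℕ => (MeasureTheory.integral
      ((Literature.MathematicalPhysics.KineticTheory.HeatConduction.pinnedChain ω₂ lam β γ).gibbsMeasure L T) (fun x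
      => (∑ i : Fin L, (Literature.MathematicalPhysics.KineticTheory.HeatConduction.pinnedChain ω₂ lam β
      γ).bondCurrent L i x) * u L x)) / ((L : ℝ) - 1)) Filter.atTop (nhds K) := by
  intro ω₂ lam β γ T ε hω hl hβ hγ hT hε s hs hs1 u hu
  refine helper_fixedAbelTLOfTimeProfile ?_ ω₂ lam β γ T ε hω hl hβ hγ hT hε s hs hs1 u hu
  intro ω₂ lam β γ T ε hω hl hβ hγ hT hε s hs _ u hu
  obtain ⟨B, c, C, hmeas, hbound, hconv, hrep⟩ := timeProfileMatching ω₂ lam β γ T ε hω hl hβ hγ hT hε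
  exact ⟨c, C, B, hmeas, hbound, hconv, fun L hL => hrep L hL s hs (u L) (hu L hL)⟩

/-- U⁺ (zero-frequency storage decay) from PS (`storageDecay_of_patternStorageDecay`, landed p148902). [folklore] -/
theorem zeroFrequencyStorageDecay :
    ∀ (ω₂ lam β γ T ε : ℝ), 0 < ω₂ → 0 < lam → 0 < β → 0 < γ → 0 < T → 0 < ε → ∃ a C : ℝ, 0 < a ∧ a ≤ 1 ∧ 0 ≤ C ∧ ∀
      (L : ℕ), 2 ≤ L → ∀ s : ℝ, 0 < s → s ≤ 1 → ∀ u :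
      Literature.MathematicalPhysics.KineticTheory.HeatConduction.PhaseSpace L → ℝ, (ContDiff ℝ 2 u ∧
      MeasureTheory.MemLp u 2 ((Literature.MathematicalPhysics.KineticTheory.HeatConduction.pinnedChain ω₂ lam β
      γ).gibbsMeasure L T) ∧ ∀ x, (Literature.MathematicalPhysics.KineticTheory.HeatConduction.pinnedChain ω₂ lam β
      γ).flipGenerator L T T ε u x = s * u x - ∑ i : Fin L,
      (Literature.MathematicalPhysics.KineticTheory.HeatConduction.pinnedChain ω₂ lam β γ).bondCurrent L i x) → s *
      MeasureTheory.integral ((Literature.MathematicalPhysics.KineticTheory.HeatConduction.pinnedChain ω₂ lam β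
      γ).gibbsMeasure L T) (fun x => u x ^ 2) ≤ C * ((L : ℝ) - 1) * s ^ a :=
  storageDecay_of_patternStorageDecay stub_patternStorageDecay

/-- P (uniform positivity of the finite-volume Kubo conductance) — now UNCONDITIONAL: the lead's Thomson witness
(`ThomsonWitness.Floor.kuboConductanceFloor`, p163165: A7 `thomsonFloor` via the bath-refined Thomson bound p160222 + witness costs,
then `kuboFloor_of_thomsonFloor` p150333); the former stub B `stub_bulkAbelGKPositivity` is LANDED in the same file (p163165). [folklore] -/
theorem kuboConductanceFloor :
    ∀ (ω₂ lam β γ T ε : ℝ), 0 < ω₂ → 0 < lam → 0 < β → 0 < γ → 0 < T → 0 < ε → ∃ c : ℝ, 0 < c ∧ ∃ L₀ : ℕ, ∀ (L : ℕ),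
      L₀ ≤ L → 2 ≤ L → ∀ g : Literature.MathematicalPhysics.KineticTheory.HeatConduction.PhaseSpace L → ℝ, (ContDiff
      ℝ 2 g ∧ MeasureTheory.MemLp g 2 ((Literature.MathematicalPhysics.KineticTheory.HeatConduction.pinnedChain ω₂
      lam β γ).gibbsMeasure L T) ∧ ∀ x, (Literature.MathematicalPhysics.KineticTheory.HeatConduction.pinnedChain ω₂
      lam β γ).flipGenerator L T T ε g x =
      -(Summit.AtomisticToContinuum.FouriersLaw.Theorems.SuperadditiveResistance.DeviceLiouville.kin L 0 x - T)) → c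
      ≤ ((L : ℝ) - 1) * (γ * (1 - γ / T ^ 2 * MeasureTheory.integral
      ((Literature.MathematicalPhysics.KineticTheory.HeatConduction.pinnedChain ω₂ lam β γ).gibbsMeasure L T) (fun x
      => g x * (Summit.AtomisticToContinuum.FouriersLaw.Theorems.SuperadditiveResistance.DeviceLiouville.kin L 0 x -
      T)))) :=
  Summit.AtomisticToContinuum.FouriersLaw.Theorems.NoisyFourier.ThomsonWitness.Floor.kuboConductanceFloor

/-- **The skeleton concludes the crux BY NAME**: `VanishingNoiseTransfer.NoisyFourier` (stmt-AtomisticToContinuum-11977)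
from the registered stubs TPM, PS, B through the landed composition `noisyFourier_of_storageDecayParts` (p148910).
[folklore] -/
theorem NoisyFourier_of : NoisyFourier :=
  noisyFourier_of_storageDecayParts fixedAbelThermodynamicLimit zeroFrequencyStorageDecay kuboConductanceFloor

end Summit.AtomisticToContinuum.FouriersLaw.Cruxes.NoisyFourier.AbelStorageDecay

end
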